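import Summits.ABC.IUTFork.Repair.RHQ3LTailBand
import Summits.ABC.IUTFork.Repair.RHHeightClassLadder
import HarnessLib

/-!
# R-H row 8 «heightclass» (`RHHeightClass.HBand`, p459046) — the λ_k K-LINE CERTIFICATE LEMMAS (seat abc-iut-rh-typ-8 gen 4; rung LADDER-ABC:A2.RESCUE.H)
(1) ties of `t ↦ p^t − t·e` sit exactly at `e = p^t·(p−1)`, so every K-line place `e_w = l·ε` with `l > p` prime is UNTIED and carries a strict minimum
`r♯` (`StrictMinPow` from ONE window check `p^t(p−1) < e < p^{t+1}(p−1)`); at a tie the typed clause fails at every label (fallback `r = e_w`).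
(2) along the K-line `l⋆ ↦ (e_w = (2l⋆+1)·ε, m_q = k·ε)` the row-8 TOP CELL «`(l⋆²−1)·kε ≤ l⋆(e_w − r♯) + 1 − r♯`» is, per exponent `t`,
`(l⋆+1)·(linear in l⋆) + (ε+1)`; hence «NEG at l⋆ = a, POS at b > a ⟹ POS at every c ≥ b» and «NEG at a, NEG at c ⟹ NEG on [a, c]»: abc-iut-rh2-q3-num's
integer rows per k (CERT-HEX-L0-v1.tsv b5a780be0dc3ac17, 2026-08-26T23:07:29Z, «with the convexity of G(l⋆)») ARE a complete certificate of «λ_k ∈ Σ₈ ⟺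
l ≥ l₀⁸(k)» on the primes l ≥ 11, BY NAME; worked in kernel for k = 6 (ε = 5): OUT for 11 ≤ l ≤ 61, IN for every prime l ≥ 67. PROOF-ONLY (0 definitions).
TAKES NO SIDE on [IUTchIII] Cor. 3.12 or on any author; nothing here asserts abc; `HBand`, `StrictMinPow`, `CertVal` are row 8's CANDIDATE vocabulary
(claim-tagged hypotheses, never asserted); «in Σ₈» = the hypothesis H⋆₈'s own clause holds at the datum's integer data, never «S holds». Bridges consumed BY
NAME: `RHHeightClass.exists_certVal_cell_iff` / `hBand_iff_cells_of_strictMin` (p460197), `hexSlice_iff`, `band_le_of_top`, `bandCell_int_iff` (p472054),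
`RH.Q3LTailBand.strictMinPow_le_pow_sub`, `hexSlice_of_k_le` / `not_hexSlice_of_k_ge` (p470688). [claim: Mochizuki2012, status: disputed] for the
candidate's reading; every statement below is [folklore] arithmetic.
-/

namespace Summit.ABC.IUTFork.Repair.RHHeightClass.KLine

open Summit.ABC.IUTFork.Repair.RHHeightClass Summit.ABC.IUTFork.Repair.RH.Q3LTailBand

/-! ## §1. Ties and strict minima of `t ↦ p^t − t·e` -/

/-- One step of `g(t) = p^t − t·e`: `g(t+1) − g(t) = p^t·(p−1) − e`. [folklore] -/
theorem pow_succ_sub_step (p e t : ℕ) :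
    ((p : ℤ) ^ (t + 1) - (t + 1 : ℕ) * e) - ((p : ℤ) ^ t - t * e) = (p : ℤ) ^ t * ((p : ℤ) - 1) - e := by
  push_cast
  ring

/-- `g` is strictly increasing from `t` on, as soon as `e < p^t·(p−1)` (`p ≥ 1`): `g(t) < g(t+s+1)` for every `s`. [folklore] -/
theorem pow_sub_lt_of_hi {p e t : ℕ} (hp : 1 ≤ p) (hhi : (e : ℤ) < (p : ℤ) ^ t * ((p : ℤ) - 1)) (s : ℕ) :
    (p : ℤ) ^ t - t * e < (p : ℤ) ^ (t + s + 1) - (t + s + 1 : ℕ) * e := by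
  induction s with
  | zero =>
    have h := pow_succ_sub_step p e t
    simp only [add_zero] at h ⊢
    linarith
  | succ s ih =>
    have h := pow_succ_sub_step p e (t + s + 1)
    have hmono : (p : ℤ) ^ t ≤ (p : ℤ) ^ (t + s + 1) :=
      pow_le_pow_right₀ (by exact_mod_cast hp) (by omega)
    have hp1 : (0 : ℤ) ≤ (p : ℤ) - 1 := by linarith [show (1 : ℤ) ≤ p by exact_mod_cast hp]
    have hstep : (e : ℤ) < (p : ℤ) ^ (t + s + 1) * ((p : ℤ) - 1) :=
      lt_of_lt_of_le hhi (mul_le_mul_of_nonneg_right hmono hp1)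
    have heq : t + (s + 1) + 1 = t + s + 1 + 1 := by ring
    rw [heq]
    linarith

/-- `g` is strictly decreasing up to `t` when `p^s·(p−1) < e` for every `s < t`: `g(t) < g(s)` for `s < t`. [folklore] -/
theorem pow_sub_lt_of_lo {p e t : ℕ} (hlo : ∀ s : ℕ, s < t → (p : ℤ) ^ s * ((p : ℤ) - 1) < e) {s : ℕ} (hs : s < t) :
    (p : ℤ) ^ t - t * e < (p : ℤ) ^ s - s * e := by
  obtain ⟨d, rfl⟩ : ∃ d, t = s + d + 1 := ⟨t - s - 1, by omega⟩
  induction d generalizing s with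
  | zero =>
    have h := pow_succ_sub_step p e s
    have := hlo s (by omega)
    simp only [add_zero] at h ⊢
    linarith
  | succ d ih =>
    have h := pow_succ_sub_step p e s
    have h0 := hlo s (by omega)
    have h1 : (p : ℤ) ^ (s + 1 + d + 1) - (s + 1 + d + 1 : ℕ) * e < (p : ℤ) ^ (s + 1) - (s + 1 : ℕ) * e :=
      ih (fun s' hs' => hlo s' (by omega)) (by omega)
    have heq : s + (d + 1) + 1 = s + 1 + d + 1 := by ring
    rw [heq]
    push_cast at h h1 ⊢
    linarith

/-- **WINDOW CERTIFICATE for the untied strict minimum.** If `p ≥ 1`, `p^s·(p−1) < e` for all `s < t` and `e < p^t·(p−1)`, then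
`r♯ := p^t − t·e` is the STRICT minimum of `s ↦ p^s − s·e` (`StrictMinPow p e r♯`). The lower checks reduce to the single one at `s = t−1`
(`strictMinPow_of_window`). [folklore] -/
theorem strictMinPow_of_lo_hi {p e t : ℕ} (hp : 1 ≤ p) (hlo : ∀ s : ℕ, s < t → (p : ℤ) ^ s * ((p : ℤ) - 1) < e)
    (hhi : (e : ℤ) < (p : ℤ) ^ t * ((p : ℤ) - 1)) : StrictMinPow p e ((p : ℤ) ^ t - t * e) := by
  refine ⟨t, rfl, fun t' ht' => ?_⟩
  rcases lt_or_gt_of_ne ht' with h | h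
  · exact pow_sub_lt_of_lo hlo h
  · obtain ⟨s, rfl⟩ : ∃ s, t' = t + s + 1 := ⟨t' - t - 1, by omega⟩
    exact pow_sub_lt_of_hi hp hhi s

/-- **WINDOW CERTIFICATE, one-check form**: `2 ≤ p`, `p^t·(p−1) < e < p^{t+1}·(p−1)` ⟹ `StrictMinPow p e (p^{t+1} − (t+1)·e)`; e.g. `(7, 305)`:
`294 < 305 < 2058`, `r♯ = 343 − 915 = −572`. [folklore] -/
theorem strictMinPow_of_window {p e t : ℕ} (hp : 2 ≤ p) (hlo : (p : ℤ) ^ t * ((p : ℤ) - 1) < e)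
    (hhi : (e : ℤ) < (p : ℤ) ^ (t + 1) * ((p : ℤ) - 1)) : StrictMinPow p e ((p : ℤ) ^ (t + 1) - (t + 1 : ℕ) * e) := by
  refine strictMinPow_of_lo_hi (by omega) (fun s hs => ?_) hhi
  have hmono : (p : ℤ) ^ s ≤ (p : ℤ) ^ t := pow_le_pow_right₀ (by exact_mod_cast (show 1 ≤ p by omega)) (by omega)
  have hp1 : (0 : ℤ) ≤ (p : ℤ) - 1 := by linarith [show (2 : ℤ) ≤ p by exact_mod_cast hp]
  exact lt_of_le_of_lt (mul_le_mul_of_nonneg_right hmono hp1) hlo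

/-- **Window certificate at `t = 0`** (the TAME range): `e < p − 1 ⟹ StrictMinPow p e 1` (`r♯ = 1`, the tame member valuation). [folklore] -/
theorem strictMinPow_of_lt_pred {p e : ℕ} (hp : 1 ≤ p) (h : (e : ℤ) < (p : ℤ) - 1) : StrictMinPow p e 1 := by
  have := strictMinPow_of_lo_hi (t := 0) hp (fun s hs => absurd hs (Nat.not_lt_zero s)) (by simpa using h)
  simpa using this

/-- **NO TIE ⟹ UNTIED.** For `p ≥ 2`: if `e ≠ p^t·(p−1)` for every `t`, then `t ↦ p^t − t·e` has a STRICT minimum (some `StrictMinPow p e r`):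
take `t` least with `e < p^t·(p−1)` (it exists: `e < 2^e ≤ p^e·(p−1)`). [folklore] -/
theorem exists_strictMinPow_of_forall_ne {p e : ℕ} (hp : 2 ≤ p) (hne : ∀ t : ℕ, p ^ t * (p - 1) ≠ e) :
    ∃ r : ℤ, StrictMinPow p e r := by
  classical
  have hex : ∃ t : ℕ, e < p ^ t * (p - 1) := by
    refine ⟨e, ?_⟩
    have h1 : e < 2 ^ e := Nat.lt_two_pow_self
    have h2 : 2 ^ e ≤ p ^ e := Nat.pow_le_pow_left hp e
    have h3 : p ^ e * 1 ≤ p ^ e * (p - 1) := Nat.mul_le_mul_left _ (by omega)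
    omega
  let T := Nat.find hex
  have hT : e < p ^ T * (p - 1) := Nat.find_spec hex
  have hlt : ∀ s, s < T → p ^ s * (p - 1) < e := fun s hs =>
    lt_of_le_of_ne (not_lt.1 (Nat.find_min hex hs)) (hne s)
  have hcast : ∀ s : ℕ, ((p ^ s * (p - 1) : ℕ) : ℤ) = (p : ℤ) ^ s * ((p : ℤ) - 1) := fun s => by
    have : 1 ≤ p := by omega
    push_cast [Nat.cast_sub this]
    ring
  refine ⟨(p : ℤ) ^ T - T * e, strictMinPow_of_lo_hi (by omega) (fun s hs => ?_) ?_⟩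
  · rw [← hcast]; exact_mod_cast hlt s hs
  · rw [← hcast]; exact_mod_cast hT

/-- **ON THE K-LINE EVERY PLACE IS UNTIED**: for primes `p < l` and any `ε`, `p^t·(p−1) ≠ l·ε` (else `l ∣ p^t(p−1)`, so `l = p` or `l ≤ p−1`). [folklore] -/
theorem pow_mul_pred_ne_of_prime_lt {p l : ℕ} (hp : p.Prime) (hl : l.Prime) (hpl : p < l) (ε t : ℕ) : p ^ t * (p - 1) ≠ l * ε := by
  intro h
  have hdvd : l ∣ p ^ t * (p - 1) := ⟨ε, h⟩
  rcases (Nat.Prime.dvd_mul hl).1 hdvd with h1 | h1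
  · have := (Nat.prime_dvd_prime_iff_eq hl hp).1 (hl.dvd_of_dvd_pow h1)
    omega
  · have := Nat.le_of_dvd (by have := hp.two_le; omega) h1
    omega

/-- **K-LINE STRICT MINIMUM**: for primes `p < l` and any `ε`, the place type `(p, e_w = l·ε)` carries a strict minimum `r♯` (`StrictMinPow p (l·ε) r♯`) —
so on every HEX `λ_k` row with `l ≥ 11 > 7 = p` the typed `HBand` clause IS the integer cell at `r♯` (`exists_certVal_cell_iff`). [folklore] -/
theorem exists_strictMinPow_kline {p l : ℕ} (hp : p.Prime) (hl : l.Prime) (hpl : p < l) (ε : ℕ) : ∃ r : ℤ, StrictMinPow p (l * ε) r :=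
  exists_strictMinPow_of_forall_ne hp.two_le (pow_mul_pred_ne_of_prime_lt hp hl hpl ε)

/-- **AT A TIE THERE IS NO STRICT MINIMUM**: if `e = p^t·(p−1)` (`p ≥ 1`) then `g(t) = g(t+1)` and no `StrictMinPow p e r` exists
(the minimiser of a `StrictMinPow` would have to be both `≤ t` and `≥ t+1`). E.g. `(7, 42)`, `(7, 6)`, `(11, 10)`. [folklore] -/
theorem not_strictMinPow_of_tie {p e t : ℕ} (hp : 1 ≤ p) (he : (e : ℤ) = (p : ℤ) ^ t * ((p : ℤ) - 1)) (r : ℤ) : ¬ StrictMinPow p e r := by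
  rintro ⟨t₀, ht₀, hmin⟩
  have hp1 : (0 : ℤ) ≤ (p : ℤ) - 1 := by linarith [show (1 : ℤ) ≤ p by exact_mod_cast hp]
  rcases Nat.lt_or_ge t₀ (t + 1) with h | h
  · -- t₀ ≤ t : g is (weakly) decreasing up to t+1, so g(t+1) ≤ g(t₀) = r, contradicting strictness at t+1 (t+1 ≠ t₀)
    have hne : t + 1 ≠ t₀ := by omega
    have hlt := hmin (t + 1) hne
    have hdec : ∀ d : ℕ, t₀ + d ≤ t + 1 → (p : ℤ) ^ (t₀ + d) - (t₀ + d : ℕ) * e ≤ (p : ℤ) ^ t₀ - t₀ * e := by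
      intro d
      induction d with
      | zero => intro _; simp
      | succ d ih =>
        intro hd
        have h1 := ih (by omega)
        have h2 := pow_succ_sub_step p e (t₀ + d)
        have hmono : (p : ℤ) ^ (t₀ + d) ≤ (p : ℤ) ^ t := pow_le_pow_right₀ (by exact_mod_cast hp) (by omega)
        have h3 : (p : ℤ) ^ (t₀ + d) * ((p : ℤ) - 1) ≤ e := by rw [he]; exact mul_le_mul_of_nonneg_right hmono hp1
        have heq : t₀ + (d + 1) = t₀ + d + 1 := by ring
        rw [heq]
        push_cast at h1 h2 ⊢
        linarith
    have := hdec (t + 1 - t₀) (by omega)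
    have heq : t₀ + (t + 1 - t₀) = t + 1 := by omega
    rw [heq, ht₀] at this
    exact absurd hlt (not_lt.2 this)
  · -- t₀ ≥ t+1 : g is (weakly) increasing from t on, so g(t) ≤ g(t₀) = r, contradicting strictness at t (t ≠ t₀)
    have hne : t ≠ t₀ := by omega
    have hlt := hmin t hne
    have hinc : ∀ d : ℕ, (p : ℤ) ^ t - t * e ≤ (p : ℤ) ^ (t + d) - (t + d : ℕ) * e := by
      intro d
      induction d with
      | zero => simp
      | succ d ih =>
        have h2 := pow_succ_sub_step p e (t + d)
        have hmono : (p : ℤ) ^ t ≤ (p : ℤ) ^ (t + d) := pow_le_pow_right₀ (by exact_mod_cast hp) (by omega)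
        have h3 : (e : ℤ) ≤ (p : ℤ) ^ (t + d) * ((p : ℤ) - 1) := by rw [he]; exact mul_le_mul_of_nonneg_right hmono hp1
        have heq : t + (d + 1) = t + d + 1 := by ring
        rw [heq]
        push_cast at ih h2 ⊢
        linarith
    have := hinc (t₀ - t)
    have heq : t + (t₀ - t) = t₀ := by omega
    rw [heq, ht₀] at this
    exact absurd hlt (not_lt.2 this)

/-- **AT A TIED PLACE ROW 8's CLAUSE FAILS AT EVERY LABEL.** With no strict minimum, `CertVal p e r` forces the fallback `r = e`, and the typed clause
`lhs ≤ c·(e − r) + (1 − r) = 1 − e` is impossible for `e ≥ 2`, `lhs ≥ 0`: on `(tie)` rows `Σ₈ ∩ (place) = ∅`, `j₀⁽⁸⁾ = 0` (SLICE.md row 8, correction 1). [folklore] -/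
theorem not_exists_certVal_cell_of_tie {p e : ℕ} (he : 2 ≤ e) (htie : ∀ r : ℤ, ¬ StrictMinPow p e r) {lhs c : ℝ} (hlhs : 0 ≤ lhs) :
    ¬ ∃ r : ℤ, CertVal p e r ∧ lhs ≤ c * ((e : ℝ) - r) + (1 - r) := by
  rintro ⟨r, hr | hr, hcell⟩
  · exact htie r hr
  · subst hr
    have : (2 : ℝ) ≤ (e : ℝ) := by exact_mod_cast he
    push_cast at hcell
    nlinarith

/-! ## §2. The top cell along the K-line: `(l⋆+1)·(linear) + (ε+1)` per exponent, hence UP-SET after a NEG and GAP-FREE NEG intervals -/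

/-- **KEY IDENTITY.** At `e = (2n+1)·ε`, member valuation `r = P − τ·e` (`P = p^τ`) and `m_q = k·ε`, the row-8 top-cell slack is
`n(e − r) + (1 − r) − (n²−1)·kε = (n+1)·((2τ+2−k)·ε·n + ((τ−1+k)·ε − P)) + (ε+1)`. [folklore] -/
theorem topSlack_eq (n P τ k ε : ℤ) :
    n * ((2 * n + 1) * ε - (P - τ * ((2 * n + 1) * ε))) + (1 - (P - τ * ((2 * n + 1) * ε))) - (n ^ 2 - 1) * (k * ε)
      = (n + 1) * ((2 * τ + 2 - k) * ε * n + ((τ - 1 + k) * ε - P)) + (ε + 1) := by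
  ring

/-- **UP-SET CORE** (integers): for `Ψ(n) = (n+1)(μ·ε·n + q) + (ε+1)` with `ε ≥ 1`, `0 ≤ a < b ≤ c`: `Ψ(a) < 0 ≤ Ψ(b) ⟹ 0 ≤ Ψ(c)`.
(`Ψ(a) < 0 ≤ Ψ(b)` forces `μ ≥ 1`; then `Ψ(c) < 0` would force `μεb + q ≤ −1 − ε`, i.e. `Ψ(b) ≤ −b(ε+1) < 0`.) This is the integer content of
«`Ψ(n)/(n+1)` is convex in `n`» (abc-iut-rh2-q3-num, 23:07:29Z). [folklore] -/
theorem upset_core {μ q ε a b c : ℤ} (hε : 1 ≤ ε) (ha : 0 ≤ a) (hab : a < b) (hbc : b ≤ c)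
    (hneg : (a + 1) * (μ * ε * a + q) + (ε + 1) < 0) (hpos : 0 ≤ (b + 1) * (μ * ε * b + q) + (ε + 1)) :
    0 ≤ (c + 1) * (μ * ε * c + q) + (ε + 1) := by
  have hAa : μ * ε * a + q < 0 := by
    rcases lt_or_ge (μ * ε * a + q) 0 with h | h
    · exact h
    · have : 0 ≤ (a + 1) * (μ * ε * a + q) := mul_nonneg (by linarith) h
      linarith
  have hμ : 1 ≤ μ := by
    rcases lt_or_ge μ 1 with h | h
    · have hμ0 : μ ≤ 0 := by omega
      have hme : μ * ε ≤ 0 := by nlinarith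
      have h1 : μ * ε * b + q ≤ μ * ε * a + q := by nlinarith
      have h2 : (b + 1) * (μ * ε * b + q) ≤ (b + 1) * (μ * ε * a + q) := mul_le_mul_of_nonneg_left h1 (by linarith)
      have h3 : (b + 1) * (μ * ε * a + q) ≤ (a + 1) * (μ * ε * a + q) := by nlinarith
      linarith
    · exact h
  rcases eq_or_lt_of_le hbc with rfl | hbc'
  · exact hpos
  · rcases lt_or_ge ((c + 1) * (μ * ε * c + q) + (ε + 1)) 0 with hc | hc
    swap
    · exact hc
    exfalso
    have hAc : μ * ε * c + q < 0 := by
      rcases lt_or_ge (μ * ε * c + q) 0 with h | h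
      · exact h
      · have : 0 ≤ (c + 1) * (μ * ε * c + q) := mul_nonneg (by linarith) h
        linarith
    have hAc' : μ * ε * c + q ≤ -1 := by omega
    have hme : ε ≤ μ * ε := by nlinarith
    have hAb : μ * ε * b + q ≤ -1 - ε := by nlinarith
    have h4 : (b + 1) * (μ * ε * b + q) ≤ (b + 1) * (-1 - ε) := mul_le_mul_of_nonneg_left hAb (by linarith)
    nlinarith

/-- **GAP-FREE CORE**: `0 ≤ a < b < c`, `Ψ(a) < 0`, `Ψ(c) < 0 ⟹ Ψ(b) < 0` (the NEG set of `Ψ` is an interval). [folklore] -/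
theorem interval_core {μ q ε a b c : ℤ} (hε : 1 ≤ ε) (ha : 0 ≤ a) (hab : a < b) (hbc : b < c)
    (hnega : (a + 1) * (μ * ε * a + q) + (ε + 1) < 0) (hnegc : (c + 1) * (μ * ε * c + q) + (ε + 1) < 0) :
    (b + 1) * (μ * ε * b + q) + (ε + 1) < 0 := by
  rcases lt_or_ge ((b + 1) * (μ * ε * b + q) + (ε + 1)) 0 with hb | hb
  · exact hb
  · have := upset_core hε ha hab hbc.le hnega hb
    linarith

/-- **UP-SET LEMMA in row 8's slice currency** (`hexSlice_iff`: `m_q = k·ε`, top label `l⋆`, `e_w = (2l⋆+1)·ε`), at a FIXED exponent `τ` (member valuation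
`r = P − τ·e_w`, `P = p^τ`): if the top cell FAILS at `l⋆ = a` and HOLDS at `l⋆ = b > a`, it HOLDS at every `l⋆ = c ≥ b`. [folklore] -/
theorem hexTop_upset {P τ k ε : ℤ} {a b c : ℕ} (hε : 1 ≤ ε) (hab : a < b) (hbc : b ≤ c)
    (hneg : ¬ (((a : ℤ)) ^ 2 - 1) * (k * ε)
        ≤ (a : ℤ) * ((2 * a + 1 : ℤ) * ε - (P - τ * ((2 * a + 1 : ℤ) * ε))) + (1 - (P - τ * ((2 * a + 1 : ℤ) * ε))))
    (hpos : (((b : ℤ)) ^ 2 - 1) * (k * ε)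
        ≤ (b : ℤ) * ((2 * b + 1 : ℤ) * ε - (P - τ * ((2 * b + 1 : ℤ) * ε))) + (1 - (P - τ * ((2 * b + 1 : ℤ) * ε)))) :
    (((c : ℤ)) ^ 2 - 1) * (k * ε)
        ≤ (c : ℤ) * ((2 * c + 1 : ℤ) * ε - (P - τ * ((2 * c + 1 : ℤ) * ε))) + (1 - (P - τ * ((2 * c + 1 : ℤ) * ε))) := by
  have ka := topSlack_eq (a : ℤ) P τ k ε
  have kb := topSlack_eq (b : ℤ) P τ k ε
  have kc := topSlack_eq (c : ℤ) P τ k ε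
  have h := upset_core (μ := 2 * τ + 2 - k) (q := (τ - 1 + k) * ε - P) (a := (a : ℤ)) (b := (b : ℤ)) (c := (c : ℤ)) hε
    (by positivity) (by exact_mod_cast hab) (by exact_mod_cast hbc) (by linarith [not_le.1 hneg]) (by linarith)
  linarith

/-- **GAP-FREE LEMMA in slice currency**, fixed exponent `τ`: the top cell FAILS at `l⋆ = a` and at `l⋆ = c > a` ⟹ it FAILS at every `l⋆` strictly between. [folklore] -/
theorem hexTop_interval {P τ k ε : ℤ} {a b c : ℕ} (hε : 1 ≤ ε) (hab : a < b) (hbc : b < c)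
    (hnega : ¬ (((a : ℤ)) ^ 2 - 1) * (k * ε)
        ≤ (a : ℤ) * ((2 * a + 1 : ℤ) * ε - (P - τ * ((2 * a + 1 : ℤ) * ε))) + (1 - (P - τ * ((2 * a + 1 : ℤ) * ε))))
    (hnegc : ¬ (((c : ℤ)) ^ 2 - 1) * (k * ε)
        ≤ (c : ℤ) * ((2 * c + 1 : ℤ) * ε - (P - τ * ((2 * c + 1 : ℤ) * ε))) + (1 - (P - τ * ((2 * c + 1 : ℤ) * ε)))) :
    ¬ (((b : ℤ)) ^ 2 - 1) * (k * ε)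
        ≤ (b : ℤ) * ((2 * b + 1 : ℤ) * ε - (P - τ * ((2 * b + 1 : ℤ) * ε))) + (1 - (P - τ * ((2 * b + 1 : ℤ) * ε))) :=
  fun hb => hnegc (hexTop_upset hε hab hbc.le hnega hb)

/-! ## §3. With the strict minimum: the cell at `r♯` ⟺ the cell at SOME exponent; the two-row / three-row CERTIFICATES -/

/-- **The band cell at the untied `r♯` holds iff it holds at `r = p^t − t·e` for SOME exponent `t`** (`r♯` is one of these values and is `≤` all of
them; the cell is antitone in `r`, `bandCell_of_le`). Integer form, any left side `L`, any label weight `n ≥ 0`. [folklore] -/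
theorem cell_strictMin_iff_exists_pow {p e : ℕ} {r : ℤ} (hr : StrictMinPow p e r) (L : ℤ) (n : ℕ) :
    L ≤ (n : ℤ) * ((e : ℤ) - r) + (1 - r) ↔ ∃ t : ℕ, L ≤ (n : ℤ) * ((e : ℤ) - ((p : ℤ) ^ t - t * e)) + (1 - ((p : ℤ) ^ t - t * e)) := by
  constructor
  · intro h
    obtain ⟨t, ht, _⟩ := hr
    exact ⟨t, by rw [ht]; exact h⟩
  · rintro ⟨t, h⟩
    have hle := strictMinPow_le_pow_sub hr t
    have hn : (0 : ℤ) ≤ n := by positivity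
    nlinarith

/-- **TWO-ROW CERTIFICATE (row 8, K-line `e_w = l·ε`, `m_q = k·ε`, `l = 2l⋆+1`).** If at `l⋆ = a` the top cell FAILS at the untied `r♯(a)`
(`StrictMinPow`) and at `l⋆ = b > a` it HOLDS at the member valuation `p^τ − τ·e_b` of SOME exponent `τ` (e.g. the minimiser `t⋆` of the POS row), then at
EVERY `l⋆ = c ≥ b` the top cell holds at every `r ≤ p^τ − τ·e_c` — in particular at the untied `r♯(c)`. This is abc-iut-rh2-q3-num's CERT-HEX-L0 logic
(«NEG at the previous prime, POS at l₀ ⟹ POS at every prime ≥ l₀»), now BY NAME. [folklore] -/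
theorem hexTop_of_two_rows {p : ℕ} {ε k : ℤ} {a b : ℕ} (hε : 1 ≤ ε) (hab : a < b) {ea : ℕ} (hea : (ea : ℤ) = (2 * a + 1 : ℤ) * ε)
    {ra : ℤ} (hra : StrictMinPow p ea ra)
    (hneg : ¬ (((a : ℤ)) ^ 2 - 1) * (k * ε) ≤ (a : ℤ) * ((ea : ℤ) - ra) + (1 - ra))
    (τ : ℕ) (hpos : (((b : ℤ)) ^ 2 - 1) * (k * ε)
        ≤ (b : ℤ) * ((2 * b + 1 : ℤ) * ε - ((p : ℤ) ^ τ - τ * ((2 * b + 1 : ℤ) * ε))) + (1 - ((p : ℤ) ^ τ - τ * ((2 * b + 1 : ℤ) * ε))))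
    {c : ℕ} (hbc : b ≤ c) {rc : ℤ} (hrc : rc ≤ (p : ℤ) ^ τ - τ * ((2 * c + 1 : ℤ) * ε)) :
    (((c : ℤ)) ^ 2 - 1) * (k * ε) ≤ (c : ℤ) * ((2 * c + 1 : ℤ) * ε - rc) + (1 - rc) := by
  have hnegτ : ¬ (((a : ℤ)) ^ 2 - 1) * (k * ε)
      ≤ (a : ℤ) * ((2 * a + 1 : ℤ) * ε - ((p : ℤ) ^ τ - τ * ((2 * a + 1 : ℤ) * ε))) + (1 - ((p : ℤ) ^ τ - τ * ((2 * a + 1 : ℤ) * ε))) := by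
    intro h
    have hle := strictMinPow_le_pow_sub hra τ
    rw [hea] at hle
    have ha0 : (0 : ℤ) ≤ a := by positivity
    apply hneg
    rw [hea]
    nlinarith
  have hc := hexTop_upset (P := (p : ℤ) ^ τ) (τ := (τ : ℤ)) hε hab hbc hnegτ hpos
  have hc0 : (0 : ℤ) ≤ c := by positivity
  nlinarith

/-- **THREE-ROW CERTIFICATE, NEG side (gap-free).** If the top cell FAILS at the untied `r♯` both at `l⋆ = a` and at `l⋆ = c > a`, then it FAILS at the
untied `r♯(b)` of every `l⋆ = b` strictly between: with the two-row certificate, «NEG at l⋆ = 5 (l = 11), NEG at p′, POS at l₀» decides the whole K-line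
from `l = 11` on. [folklore] -/
theorem not_hexTop_between {p : ℕ} {ε k : ℤ} {a b c : ℕ} (hε : 1 ≤ ε) (hab : a < b) (hbc : b < c)
    {ea eb ec : ℕ} (hea : (ea : ℤ) = (2 * a + 1 : ℤ) * ε) (heb : (eb : ℤ) = (2 * b + 1 : ℤ) * ε) (hec : (ec : ℤ) = (2 * c + 1 : ℤ) * ε)
    {ra rb rc : ℤ} (hra : StrictMinPow p ea ra) (hrb : StrictMinPow p eb rb) (hrc : StrictMinPow p ec rc)
    (hnega : ¬ (((a : ℤ)) ^ 2 - 1) * (k * ε) ≤ (a : ℤ) * ((ea : ℤ) - ra) + (1 - ra))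
    (hnegc : ¬ (((c : ℤ)) ^ 2 - 1) * (k * ε) ≤ (c : ℤ) * ((ec : ℤ) - rc) + (1 - rc)) :
    ¬ (((b : ℤ)) ^ 2 - 1) * (k * ε) ≤ (b : ℤ) * ((eb : ℤ) - rb) + (1 - rb) := by
  intro hb
  obtain ⟨τ, hτ⟩ := (cell_strictMin_iff_exists_pow hrb _ b).1 hb
  rw [heb] at hτ
  have hle := strictMinPow_le_pow_sub hrc τ
  rw [hec] at hle
  have := hexTop_of_two_rows hε hab hea hra hnega τ hτ hbc.le hle
  exact hnegc (by rw [hec]; exact this)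

/-! ## §4. Worked K-line in kernel: `λ₆` (`p = 7`, `ε = 5`, `k = 6`, `m_q = 30`): OUT of Σ₈ for `11 ≤ l ≤ 61`, IN for every prime `l ≥ 67`
(CERT-HEX-L0-v1 row k = 6: l₀ = 67, e_w = 335, r♯ = −662, t⋆ = 3; p′ = 61 NEG; plus the l = 11 NEG of the l = 11 ladder `hexSlice_7_55_11`). -/

/-- `r♯(7, 305) = −572`, UNTIED (`l = 61`, `ε = 5`; window `7²·6 = 294 < 305 < 2058 = 7³·6`, `t⋆ = 3`). [folklore] -/
theorem strictMinPow_7_305 : StrictMinPow 7 305 (-572) := by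
  have := strictMinPow_of_window (p := 7) (e := 305) (t := 2) (by norm_num) (by norm_num) (by norm_num)
  norm_num at this
  exact this

/-- `r♯(7, 335) = −662`, UNTIED (`l = 67`, `ε = 5`; window `294 < 335 < 2058`, `t⋆ = 3`) — CERT-HEX-L0-v1 row `k = 6`. [folklore] -/
theorem strictMinPow_7_335 : StrictMinPow 7 335 (-662) := by
  have := strictMinPow_of_window (p := 7) (e := 335) (t := 2) (by norm_num) (by norm_num) (by norm_num)
  norm_num at this
  exact this

/-- **λ₆ NEG rows**: the top cell FAILS at `l = 11` (`l⋆ = 5`, `e = 55`, `r♯ = −61`: `720 > 642`) and at `l = 61` (`l⋆ = 30`, `e = 305`, `r♯ = −572`: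
`26970 > 26883`). [folklore] -/
theorem lambda6_neg_11_61 :
    ¬ ((((5 : ℕ) : ℤ)) ^ 2 - 1) * ((6 : ℤ) * 5) ≤ ((5 : ℕ) : ℤ) * ((((55 : ℕ)) : ℤ) - (-61)) + (1 - (-61)) ∧
      ¬ ((((30 : ℕ) : ℤ)) ^ 2 - 1) * ((6 : ℤ) * 5) ≤ ((30 : ℕ) : ℤ) * ((((305 : ℕ)) : ℤ) - (-572)) + (1 - (-572)) := by
  constructor <;> norm_num

/-- **λ₆ POS row**: at `l₀ = 67` (`l⋆ = 33`, `e = 335`) the top cell HOLDS at the exponent-3 valuation `343 − 3·335 = −662 = r♯`: `32640 ≤ 33564`. [folklore] -/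
theorem lambda6_pos_67 :
    ((((33 : ℕ) : ℤ)) ^ 2 - 1) * ((6 : ℤ) * 5)
      ≤ ((33 : ℕ) : ℤ) * ((2 * (33 : ℕ) + 1 : ℤ) * 5 - ((7 : ℤ) ^ (3 : ℕ) - ((3 : ℕ) : ℤ) * ((2 * (33 : ℕ) + 1 : ℤ) * 5)))
        + (1 - ((7 : ℤ) ^ (3 : ℕ) - ((3 : ℕ) : ℤ) * ((2 * (33 : ℕ) + 1 : ℤ) * 5))) := by
  norm_num

/-- **λ₆ IS IN Σ₈ FOR EVERY PRIME `l ≥ 67`** (row-8 top cell at the untied `r♯(7, 5l)`, which exists since `l > 7`; with `band_le_of_top` every label follows,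
and with `exists_certVal_cell_iff` this IS the typed `HBand` clause at such a place): the CERT-HEX-L0-v1 row `k = 6` discharged by name. [folklore] -/
theorem lambda6_in_sigma8_of_ge_67 {l : ℕ} (hl : l.Prime) (h67 : 67 ≤ l) :
    (∃ r : ℤ, StrictMinPow 7 (l * 5) r) ∧
      ∀ r : ℤ, StrictMinPow 7 (l * 5) r →
        ((((l / 2 : ℕ) : ℤ)) ^ 2 - 1) * ((6 : ℤ) * 5) ≤ ((l / 2 : ℕ) : ℤ) * (((l * 5 : ℕ) : ℤ) - r) + (1 - r) := by
  have hodd : l % 2 = 1 := Nat.odd_iff.1 (hl.odd_of_ne_two (by omega))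
  refine ⟨exists_strictMinPow_kline (p := 7) (by norm_num) hl (by omega) 5, fun r hr => ?_⟩
  have hc : (33 : ℕ) ≤ l / 2 := by omega
  have hcast : ((l * 5 : ℕ) : ℤ) = (2 * ((l / 2 : ℕ) : ℤ) + 1) * 5 := by omega
  have hle := strictMinPow_le_pow_sub hr 3
  rw [hcast] at hle ⊢
  exact hexTop_of_two_rows (p := 7) (ε := 5) (k := 6) (a := 30) (b := 33) (by norm_num) (by norm_num) (ea := 305) (by norm_num)
    strictMinPow_7_305 lambda6_neg_11_61.2 3 lambda6_pos_67 hc hle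

/-- **λ₆ IS OUT OF Σ₈ FOR `11 ≤ l ≤ 61`** (every `l⋆` with `5 ≤ l⋆ ≤ 30`; at the untied `r♯`, which exists for prime `l > 7`): the top cell fails, so by
`exists_certVal_cell_iff` the typed `HBand` fails at such a place. Gap-free side of the certificate. [folklore] -/
theorem lambda6_out_sigma8_of_le_61 {l : ℕ} (hl : l.Prime) (h11 : 11 ≤ l) (h61 : l ≤ 61) :
    ∀ r : ℤ, StrictMinPow 7 (l * 5) r →
      ¬ ((((l / 2 : ℕ) : ℤ)) ^ 2 - 1) * ((6 : ℤ) * 5) ≤ ((l / 2 : ℕ) : ℤ) * (((l * 5 : ℕ) : ℤ) - r) + (1 - r) := by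
  intro r hr
  have hodd : l % 2 = 1 := Nat.odd_iff.1 (hl.odd_of_ne_two (by omega))
  have hcast : ((l * 5 : ℕ) : ℤ) = (2 * ((l / 2 : ℕ) : ℤ) + 1) * 5 := by omega
  rcases Nat.lt_or_ge (l / 2) 6 with h5 | h6
  · have hl11 : l = 11 := by omega
    subst hl11
    have hr' : r = -61 := strictMinPow_unique hr strictMinPow_7_55
    subst hr'
    norm_num
  rcases Nat.lt_or_ge (l / 2) 30 with h30 | h30'
  · exact not_hexTop_between (p := 7) (ε := 5) (k := 6) (a := 5) (b := l / 2) (c := 30) (by norm_num) (by omega) (by omega)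
      (ea := 55) (eb := l * 5) (ec := 305) (by norm_num) hcast (by norm_num) strictMinPow_7_55 hr strictMinPow_7_305
      lambda6_neg_11_61.1 lambda6_neg_11_61.2
  · have hl61 : l = 61 := by omega
    subst hl61
    have hr' : r = -572 := strictMinPow_unique hr strictMinPow_7_305
    subst hr'
    norm_num

end Summit.ABC.IUTFork.Repair.RHHeightClass.KLine
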